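import Mathlib
import HarnessLib

/-!
# ValiantsHypothesis / LacunarySymmetroid — crux `MatrixDescartes` (stmt-ValiantsHypothesis-18050, V1),
# line `Cruxes/MatrixDescartes/Lines/osculation_law.lean` («osculation-law»): the RANK-ONE PEEL, arc lemma

At rank `r = 1` the inserted pencil has determinant `g = f + c·X^N·a` (`f = det G`, `a = det G₂₂`).  Write
`θ = X·d/dX`, `W(h) = h·θ²h − (θh)²`, `R = W(f)·a² − W(a)·f²` and `P₁ = X·(f'·a − f·a') − N·f·a`.  On an open arc
`I ⊆ (0,∞)` on which `f`, `a` and `R` do not vanish, `g` has AT MOST TWO roots counted with multiplicity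
(`card_roots_filter_arc_le_two`).  Mechanism («a line meets a log-log-inflection-free arc at most twice»), run
entirely with polynomials and Rolle's theorem:

* `F = f/(X^N·a)` takes the value `−c` at every root of `g`; `t·(F'·(X^N a)²) = X^N·P₁`, so between two roots
  of `g` there is a root of `P₁` (`exists_root_P1`); a double root of `g` is itself a root of `P₁`
  (`isRoot_P1_of_rootMultiplicity`), a triple root is a root of `R` (`isRoot_R_of_rootMultiplicity`);
* `G = P₁/(f·a)`: `t·(G'·(fa)²) = θP₁·(fa) − P₁·θ(fa) = R` (the identity `theta_P1_sub`), so between two roots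
  of `P₁` there is a root of `R` (`exists_root_R`);
* three roots of `g` with multiplicity on `I` therefore force a root of `R` on `I`.

Everything is stated for ARBITRARY `f a : ℝ[X]`; `…OsculationLawPeelRankOne` assembles the line's `PeelInequality`
at `r = 1` from it.  Honest framing: bookkeeping for an UNREGISTERED alternative line of the V1 crux; the
line's `stub_peel` (all ranks `r`), its LAW `stub_osculationLaw`, `stub_recursion`, `MatrixDescartes`, Conjecture B
and `VP ≠ VNP` are OPEN / NOT proved and nothing here is progress on them.  No definitions, no named facts;
Mathlib only.
-/

-- `Summit.ValiantsHypothesis.ValiantsHypothesis.…` is the tree's mandated single-conjunct layout (Sub = Summit).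
set_option linter.dupNamespace false

noncomputable section

namespace Summit.ValiantsHypothesis.ValiantsHypothesis.Theorems.LacunarySymmetroidMatrixDescartes

open Polynomial Set
open scoped BigOperators

namespace OsculationPeel

/-! ### Polynomial identities -/

/-- `θP₁·(fa) − P₁·θ(fa) = R` for `P₁ = X(f'a − fa') − N·fa`, `R = W(f)a² − W(a)f²`. [folklore] -/
theorem theta_P1_sub (f a : ℝ[X]) (N : ℕ) :
    X * derivative (X * (derivative f * a - f * derivative a) - C (N : ℝ) * (f * a)) * (f * a)
        - (X * (derivative f * a - f * derivative a) - C (N : ℝ) * (f * a)) * (X * derivative (f * a)) =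
      (f * (X * derivative (X * derivative f)) - (X * derivative f) ^ 2) * a ^ 2
        - (a * (X * derivative (X * derivative a)) - (X * derivative a) ^ 2) * f ^ 2 := by
  simp only [derivative_mul, derivative_sub, derivative_X, derivative_C, one_mul, zero_mul, zero_add]
  ring

/-- Evaluated form of `theta_P1_sub`. [folklore] -/
theorem theta_P1_sub_eval (f a : ℝ[X]) (N : ℕ) (t : ℝ) :
    t * ((derivative (X * (derivative f * a - f * derivative a) - C (N : ℝ) * (f * a))).eval t
          * (f.eval t * a.eval t)
        - (X * (derivative f * a - f * derivative a) - C (N : ℝ) * (f * a)).eval t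
          * (derivative (f * a)).eval t) =
      ((f * (X * derivative (X * derivative f)) - (X * derivative f) ^ 2) * a ^ 2
        - (a * (X * derivative (X * derivative a)) - (X * derivative a) ^ 2) * f ^ 2).eval t := by
  simp only [derivative_mul, derivative_sub, derivative_X, derivative_C, one_mul, zero_mul, zero_add,
    eval_mul, eval_sub, eval_add, eval_X, eval_C, eval_pow]
  ring

/-! ### Roots of `g = f + c X^N a` of multiplicity ≥ 2, ≥ 3 -/

/-- A double root of `g = f + c·X^N·a` is a root of `P₁`. [folklore] -/
theorem isRoot_P1_of_rootMultiplicity (f a : ℝ[X]) (c : ℝ) (N : ℕ) {t : ℝ}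
    (hg : f + C c * X ^ N * a ≠ 0) (h2 : 1 < (f + C c * X ^ N * a).rootMultiplicity t) :
    (X * (derivative f * a - f * derivative a) - C (N : ℝ) * (f * a)).IsRoot t := by
  set g := f + C c * X ^ N * a with hg'
  have h0 : g.IsRoot t := (rootMultiplicity_pos hg).1 (by omega)
  have h1 : (derivative g).IsRoot t := by
    have := rootMultiplicity_sub_one_le_derivative_rootMultiplicity g t
    have hpos : 0 < (derivative g).rootMultiplicity t := by omega
    exact ((rootMultiplicity_pos') |>.1 hpos).2
  simp only [hg', IsRoot.def, eval_add, eval_mul, eval_C, eval_pow, eval_X, derivative_add, derivative_mul,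
    derivative_C, zero_mul, zero_add, derivative_X_pow] at h0 h1
  simp only [IsRoot.def, eval_sub, eval_mul, eval_X, eval_C]
  -- from `h0`: f t = -(c t^N a t); from `h1`: f' t = -c (N t^(N-1) a t + t^N a' t)
  have hf : f.eval t = -(c * t ^ N * a.eval t) := by linarith
  have hf' : (derivative f).eval t = -(c * ((N : ℝ) * t ^ (N - 1)) * a.eval t + c * t ^ N * (derivative a).eval t) := by
    linarith
  rw [hf, hf']
  rcases Nat.eq_zero_or_pos N with hN | hN
  · subst hN
    simp only [Nat.cast_zero, zero_mul, mul_zero, pow_zero, sub_zero, mul_one]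
    ring
  · have ht : t * t ^ (N - 1) = t ^ N := by
      rw [← pow_succ']; congr 1; omega
    calc t * ((-(c * (↑N * t ^ (N - 1)) * eval t a + c * t ^ N * eval t (derivative a))) * eval t a
            - (-(c * t ^ N * eval t a)) * eval t (derivative a)) - ↑N * ((-(c * t ^ N * eval t a)) * eval t a)
          = -(c * ↑N * (t * t ^ (N - 1)) * eval t a * eval t a) + ↑N * (c * t ^ N * eval t a * eval t a) := by ring
      _ = 0 := by rw [ht]; ring

/-- A triple root of `g = f + c·X^N·a` is a root of `R = W(f)a² − W(a)f²`. [folklore] -/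
theorem isRoot_R_of_rootMultiplicity (f a : ℝ[X]) (c : ℝ) (N : ℕ) {t : ℝ}
    (hg : f + C c * X ^ N * a ≠ 0) (h3 : 2 < (f + C c * X ^ N * a).rootMultiplicity t) :
    ((f * (X * derivative (X * derivative f)) - (X * derivative f) ^ 2) * a ^ 2
        - (a * (X * derivative (X * derivative a)) - (X * derivative a) ^ 2) * f ^ 2).IsRoot t := by
  set g := f + C c * X ^ N * a with hg'
  have hP1 := isRoot_P1_of_rootMultiplicity f a c N (t := t) hg (by rw [← hg']; omega)
  have h0 : g.IsRoot t := (rootMultiplicity_pos hg).1 (by omega)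
  have hd1 := rootMultiplicity_sub_one_le_derivative_rootMultiplicity g t
  have hd2 := rootMultiplicity_sub_one_le_derivative_rootMultiplicity (derivative g) t
  have h1 : (derivative g).IsRoot t := ((rootMultiplicity_pos') |>.1 (by omega)).2
  have h2 : (derivative (derivative g)).IsRoot t := ((rootMultiplicity_pos') |>.1 (by omega)).2
  -- `P₁'(t) = 0` from the three vanishing conditions
  have hP1' : (derivative (X * (derivative f * a - f * derivative a) - C (N : ℝ) * (f * a))).IsRoot t := by
    simp only [hg', IsRoot.def, eval_add, eval_mul, eval_C, eval_pow, eval_X, derivative_add, derivative_mul,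
      derivative_C, zero_mul, zero_add, derivative_X_pow, derivative_sub, derivative_X, one_mul, eval_sub,
      map_natCast, eval_natCast, derivative_natCast] at h0 h1 h2 ⊢
    have hf : f.eval t = -(c * t ^ N * a.eval t) := by linarith
    have hf' : (derivative f).eval t =
        -(c * ((N : ℝ) * t ^ (N - 1)) * a.eval t + c * t ^ N * (derivative a).eval t) := by linarith
    have hf'' : (derivative (derivative f)).eval t =
        -(c * ((N : ℝ) * (((N - 1 : ℕ) : ℝ) * t ^ (N - 1 - 1))) * a.eval t
          + c * ((N : ℝ) * t ^ (N - 1)) * (derivative a).eval t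
          + (c * ((N : ℝ) * t ^ (N - 1)) * (derivative a).eval t
            + c * t ^ N * (derivative (derivative a)).eval t)) := by linarith
    rw [hf, hf', hf'']
    rcases Nat.lt_or_ge N 2 with hN | hN
    · interval_cases N
      · norm_num
        ring
      · norm_num
        ring
    · obtain ⟨M, rfl⟩ : ∃ M, N = M + 2 := ⟨N - 2, by omega⟩
      simp only [Nat.add_sub_cancel, show M + 2 - 1 = M + 1 from rfl, Nat.cast_add, Nat.cast_ofNat,
        Nat.cast_one, pow_succ]
      ring
  -- conclude with the identity `θP₁·fa − P₁·θ(fa) = R` at `t`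
  rw [IsRoot.def, ← theta_P1_sub_eval]
  rw [IsRoot.def] at hP1 hP1'
  rw [hP1, hP1']
  ring


/-! ### Rolle, twice -/

/-- Between two positive roots of `g = f + c·X^N·a` on an interval free of zeros of `a` lies a root of `P₁`
(Rolle for `F = f/(X^N a)`, which equals `−c` at every root of `g`). [folklore: Rolle] -/
theorem exists_root_P1 (f a : ℝ[X]) (c : ℝ) (N : ℕ) {x y : ℝ} (hxy : x < y) (hx0 : 0 < x)
    (ha : ∀ t ∈ Icc x y, a.eval t ≠ 0)
    (hgx : (f + C c * X ^ N * a).IsRoot x) (hgy : (f + C c * X ^ N * a).IsRoot y) :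
    ∃ z ∈ Ioo x y, (X * (derivative f * a - f * derivative a) - C (N : ℝ) * (f * a)).IsRoot z := by
  have hden : ∀ t ∈ Icc x y, t ^ N * a.eval t ≠ 0 := fun t ht =>
    mul_ne_zero (pow_ne_zero _ (lt_of_lt_of_le hx0 ht.1).ne') (ha t ht)
  -- `F = f/(X^N a)` is `-c` at both ends
  have hval : ∀ t ∈ Icc x y, (f + C c * X ^ N * a).IsRoot t → f.eval t / (t ^ N * a.eval t) = -c := by
    intro t ht hroot
    simp only [IsRoot.def, eval_add, eval_mul, eval_C, eval_pow, eval_X] at hroot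
    rw [div_eq_iff (hden t ht)]
    linarith
  have hcont : ContinuousOn (fun t => f.eval t / (t ^ N * a.eval t)) (Icc x y) :=
    (f.continuous.continuousOn).div ((continuous_pow N).mul a.continuous).continuousOn hden
  have hderiv : ∀ t ∈ Ioo x y, HasDerivAt (fun t => f.eval t / (t ^ N * a.eval t))
      (((derivative f).eval t * (t ^ N * a.eval t)
        - f.eval t * ((N : ℝ) * t ^ (N - 1) * a.eval t + t ^ N * (derivative a).eval t)) / (t ^ N * a.eval t) ^ 2) t := by
    intro t ht
    have h1 := f.hasDerivAt t
    have h2 := ((hasDerivAt_pow N t).mul (a.hasDerivAt t))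
    exact h1.div h2 (hden t (Ioo_subset_Icc_self ht))
  obtain ⟨z, hz, hz0⟩ := exists_hasDerivAt_eq_zero hxy hcont
    (by rw [hval x (left_mem_Icc.2 hxy.le) hgx, hval y (right_mem_Icc.2 hxy.le) hgy]) hderiv
  refine ⟨z, hz, ?_⟩
  have hz0' : (derivative f).eval z * (z ^ N * a.eval z)
      - f.eval z * ((N : ℝ) * z ^ (N - 1) * a.eval z + z ^ N * (derivative a).eval z) = 0 := by
    rcases (div_eq_zero_iff.1 hz0) with h | h
    · exact h
    · exact absurd (pow_eq_zero_iff two_ne_zero |>.1 h) (hden z (Ioo_subset_Icc_self hz))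
  have hzpos : 0 < z := hx0.trans hz.1
  have hzN : (z ^ N : ℝ) ≠ 0 := pow_ne_zero _ hzpos.ne'
  -- `z^N · P₁(z) = z · (numerator of F')`
  have key : z ^ N * (X * (derivative f * a - f * derivative a) - C (N : ℝ) * (f * a)).eval z =
      z * ((derivative f).eval z * (z ^ N * a.eval z)
        - f.eval z * ((N : ℝ) * z ^ (N - 1) * a.eval z + z ^ N * (derivative a).eval z)) := by
    simp only [eval_sub, eval_mul, eval_X, eval_C]
    rcases Nat.eq_zero_or_pos N with hN | hN
    · subst hN
      simp only [pow_zero, Nat.cast_zero, zero_mul, one_mul, sub_zero, zero_add]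
    · have ht : z * z ^ (N - 1) = z ^ N := by
        rw [← pow_succ']; congr 1; omega
      calc z ^ N * (z * (eval z (derivative f) * eval z a - eval z f * eval z (derivative a)) - ↑N * (eval z f * eval z a))
            = z * (eval z (derivative f) * (z ^ N * eval z a) - eval z f * (z ^ N * eval z (derivative a)))
              - ↑N * z ^ N * (eval z f * eval z a) := by ring
        _ = z * (eval z (derivative f) * (z ^ N * eval z a) - eval z f * (z ^ N * eval z (derivative a)))
              - ↑N * (z * z ^ (N - 1)) * (eval z f * eval z a) := by rw [ht]
        _ = _ := by ring
  rw [hz0', mul_zero] at key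
  rcases mul_eq_zero.1 key with h | h
  · exact absurd h hzN
  · exact h

/-- Between two positive roots of `P₁` on an interval free of zeros of `f·a` lies a root of `R`
(Rolle for `G = P₁/(f a)`; `t·(numerator of G') = R` by `theta_P1_sub`). [folklore: Rolle] -/
theorem exists_root_R (f a : ℝ[X]) (N : ℕ) {x y : ℝ} (hxy : x < y)
    (hfa : ∀ t ∈ Icc x y, f.eval t * a.eval t ≠ 0)
    (hPx : (X * (derivative f * a - f * derivative a) - C (N : ℝ) * (f * a)).IsRoot x)
    (hPy : (X * (derivative f * a - f * derivative a) - C (N : ℝ) * (f * a)).IsRoot y) :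
    ∃ z ∈ Ioo x y, ((f * (X * derivative (X * derivative f)) - (X * derivative f) ^ 2) * a ^ 2
        - (a * (X * derivative (X * derivative a)) - (X * derivative a) ^ 2) * f ^ 2).IsRoot z := by
  set P₁ : ℝ[X] := X * (derivative f * a - f * derivative a) - C (N : ℝ) * (f * a) with hP₁
  have hfa' : ∀ t ∈ Icc x y, (f * a).eval t ≠ 0 := fun t ht => by rw [eval_mul]; exact hfa t ht
  have hcont : ContinuousOn (fun t => P₁.eval t / (f * a).eval t) (Icc x y) :=
    (P₁.continuous.continuousOn).div (f * a).continuous.continuousOn hfa'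
  have hderiv : ∀ t ∈ Ioo x y, HasDerivAt (fun t => P₁.eval t / (f * a).eval t)
      (((derivative P₁).eval t * (f * a).eval t - P₁.eval t * (derivative (f * a)).eval t)
        / ((f * a).eval t) ^ 2) t := fun t ht =>
    (P₁.hasDerivAt t).div ((f * a).hasDerivAt t) (hfa' t (Ioo_subset_Icc_self ht))
  have hends : P₁.eval x / (f * a).eval x = P₁.eval y / (f * a).eval y := by
    rw [IsRoot.def] at hPx hPy
    rw [hPx, hPy, zero_div, zero_div]
  obtain ⟨z, hz, hz0⟩ := exists_hasDerivAt_eq_zero hxy hcont hends hderiv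
  refine ⟨z, hz, ?_⟩
  have hnum : (derivative P₁).eval z * (f * a).eval z - P₁.eval z * (derivative (f * a)).eval z = 0 := by
    rcases (div_eq_zero_iff.1 hz0) with h | h
    · exact h
    · exact absurd (pow_eq_zero_iff two_ne_zero |>.1 h) (hfa' z (Ioo_subset_Icc_self hz))
  have key := theta_P1_sub_eval f a N z
  rw [eval_mul] at hnum
  rw [IsRoot.def, ← key, hnum, mul_zero]

/-! ### The arc lemma -/

/-- **Arc lemma.**  On an open arc `(α, β) ⊆ (0, ∞)` on which `f`, `a` and `R = W(f)a² − W(a)f²` have no zero,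
`g = f + c·X^N·a` has at most two roots counted with multiplicity («a line meets a log-log-inflection-free arc of
the curve `b = −f/a` at most twice»). [folklore] -/
theorem card_roots_filter_arc_le_two (f a : ℝ[X]) (c : ℝ) (N : ℕ) {α β : ℝ} (hα : 0 ≤ α)
    (hf : ∀ t, α < t → t < β → f.eval t ≠ 0) (ha : ∀ t, α < t → t < β → a.eval t ≠ 0)
    (hR : ∀ t, α < t → t < β → ¬ ((f * (X * derivative (X * derivative f)) - (X * derivative f) ^ 2) * a ^ 2
        - (a * (X * derivative (X * derivative a)) - (X * derivative a) ^ 2) * f ^ 2).IsRoot t) :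
    Multiset.card ((f + C c * X ^ N * a).roots.filter (fun t => α < t ∧ t < β)) ≤ 2 := by
  classical
  set g : ℝ[X] := f + C c * X ^ N * a with hg
  set P₁ : ℝ[X] := X * (derivative f * a - f * derivative a) - C (N : ℝ) * (f * a) with hP₁
  by_cases hg0 : g = 0
  · simp [hg0]
  set M := g.roots.filter (fun t => α < t ∧ t < β) with hM
  set D := M.toFinset with hD
  -- membership
  have memD : ∀ x ∈ D, (α < x ∧ x < β) ∧ g.IsRoot x := by
    intro x hx
    rw [hD, Multiset.mem_toFinset, hM, Multiset.mem_filter, mem_roots hg0] at hx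
    exact ⟨hx.2, hx.1⟩
  have countD : ∀ x ∈ D, M.count x = g.rootMultiplicity x := by
    intro x hx
    rw [hM, Multiset.count_filter_of_pos (p := fun t => α < t ∧ t < β) (memD x hx).1, count_roots]
  -- H1: between two roots of `g` in the arc, a root of `P₁`
  have H1 : ∀ x y, x ∈ D → y ∈ D → x < y → ∃ z ∈ Ioo x y, P₁.IsRoot z := by
    intro x y hx hy hxy
    obtain ⟨⟨hxα, hxβ⟩, hgx⟩ := memD x hx
    obtain ⟨⟨hyα, hyβ⟩, hgy⟩ := memD y hy
    exact exists_root_P1 f a c N hxy (lt_of_le_of_lt hα hxα)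
      (fun t ht => ha t (lt_of_lt_of_le hxα ht.1) (lt_of_le_of_lt ht.2 hyβ)) hgx hgy
  -- H2: two roots of `P₁` in the arc are impossible
  have H2 : ∀ u v, α < u → v < β → u < v → P₁.IsRoot u → P₁.IsRoot v → False := by
    intro u v hu hv huv hPu hPv
    obtain ⟨w, hw, hRw⟩ := exists_root_R f a N huv
      (fun t ht => mul_ne_zero (hf t (lt_of_lt_of_le hu ht.1) (lt_of_le_of_lt ht.2 hv))
        (ha t (lt_of_lt_of_le hu ht.1) (lt_of_le_of_lt ht.2 hv))) hPu hPv
    exact hR w (hu.trans hw.1) (hw.2.trans hv) hRw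
  -- the count
  by_contra hcard
  push Not at hcard
  have hsum : Multiset.card M = ∑ x ∈ D, M.count x := (Multiset.toFinset_sum_count_eq M).symm
  by_cases h3 : ∃ x ∈ D, 3 ≤ M.count x
  · obtain ⟨x, hx, h3x⟩ := h3
    rw [countD x hx] at h3x
    obtain ⟨⟨hxα, hxβ⟩, -⟩ := memD x hx
    exact hR x hxα hxβ (isRoot_R_of_rootMultiplicity f a c N hg0 (by rw [← hg]; omega))
  push Not at h3
  by_cases h2 : ∃ x ∈ D, M.count x = 2
  · obtain ⟨x, hx, h2x⟩ := h2
    obtain ⟨⟨hxα, hxβ⟩, -⟩ := memD x hx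
    have hPx : P₁.IsRoot x := by
      rw [countD x hx] at h2x
      exact isRoot_P1_of_rootMultiplicity f a c N hg0 (by rw [← hg]; omega)
    -- a second root
    have hy : ∃ y ∈ D, y ≠ x := by
      by_contra hno
      push Not at hno
      have hDx : D = {x} := Finset.eq_singleton_iff_unique_mem.2 ⟨hx, hno⟩
      rw [hsum, hDx, Finset.sum_singleton, h2x] at hcard
      omega
    obtain ⟨y, hy, hyx⟩ := hy
    obtain ⟨⟨hyα, hyβ⟩, -⟩ := memD y hy
    rcases lt_or_gt_of_ne hyx with hlt | hlt
    · obtain ⟨z, hz, hPz⟩ := H1 y x hy hx hlt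
      exact H2 z x (hyα.trans hz.1) hxβ hz.2 hPz hPx
    · obtain ⟨z, hz, hPz⟩ := H1 x y hx hy hlt
      exact H2 x z hxα (hz.2.trans hyβ) hz.1 hPx hPz
  push Not at h2
  -- all roots simple: `D` has at least three elements
  have hle1 : ∀ x ∈ D, M.count x ≤ 1 := by
    intro x hx
    have := h3 x hx
    have := h2 x hx
    omega
  have hDcard : 3 ≤ D.card := by
    have : Multiset.card M ≤ ∑ x ∈ D, 1 := hsum ▸ Finset.sum_le_sum hle1
    simp only [Finset.sum_const, smul_eq_mul, mul_one] at this
    omega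
  have hDne : D.Nonempty := Finset.card_pos.1 (by omega)
  set x₁ := D.min' hDne with hx₁
  set x₃ := D.max' hDne with hx₃
  have hx₁D : x₁ ∈ D := Finset.min'_mem D hDne
  have hx₃D : x₃ ∈ D := Finset.max'_mem D hDne
  have hD' : ((D.erase x₁).erase x₃).Nonempty := by
    apply Finset.card_pos.1
    have h1 := Finset.pred_card_le_card_erase (s := D) (a := x₁)
    have h2 := Finset.pred_card_le_card_erase (s := D.erase x₁) (a := x₃)
    omega
  obtain ⟨x₂, hx₂⟩ := hD'
  have hx₂3 : x₂ ≠ x₃ := Finset.ne_of_mem_erase hx₂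
  have hx₂' : x₂ ∈ D.erase x₁ := Finset.mem_of_mem_erase hx₂
  have hx₂1 : x₂ ≠ x₁ := Finset.ne_of_mem_erase hx₂'
  have hx₂D : x₂ ∈ D := Finset.mem_of_mem_erase hx₂'
  have h12 : x₁ < x₂ := lt_of_le_of_ne (Finset.min'_le D x₂ hx₂D) (Ne.symm hx₂1)
  have h23 : x₂ < x₃ := lt_of_le_of_ne (Finset.le_max' D x₂ hx₂D) hx₂3
  obtain ⟨z₁, hz₁, hPz₁⟩ := H1 x₁ x₂ hx₁D hx₂D h12
  obtain ⟨z₂, hz₂, hPz₂⟩ := H1 x₂ x₃ hx₂D hx₃D h23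
  obtain ⟨⟨h1α, -⟩, -⟩ := memD x₁ hx₁D
  obtain ⟨⟨-, h3β⟩, -⟩ := memD x₃ hx₃D
  exact H2 z₁ z₂ (h1α.trans hz₁.1) (hz₂.2.trans h3β) (hz₁.2.trans hz₂.1) hPz₁ hPz₂

end OsculationPeel

end Summit.ValiantsHypothesis.ValiantsHypothesis.Theorems.LacunarySymmetroidMatrixDescartes
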